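import Summits.BirchSwinnertonDyer.Rank1Residual.X5.SelmerSolitaireQuadraticMove
import Summits.BirchSwinnertonDyer.Rank1Residual.X5.SelmerSolitaireQuadraticDescent
import Summits.BirchSwinnertonDyer.Rank1Residual.X5.SelmerSolitaireQuadraticParityFlip
import HarnessLib

/-!
# X5 · Selmer solitaire, quadratic layer — the DESCENT TRICHOTOMY at a move (lens-2 D-G10.1, the
# `0` and `+1` companions of QS5): `Δλ* ∈ {−1, 0, +1}` according to `ψ` on `U ∩ Λ*_n` / `U ∩ Λ_n`

HONEST FRAMING (cell `b2b-bsdres`, run/shared/lean/b2b/bsd-rank1-residual/, verbatim in every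
file): the goal of the cell is to DELETE the COMBINATION-SHAPED residual classes of the
Birch–Swinnerton-Dyer formula for ALL analytic-rank `≤ 1` elliptic curves over `ℚ` — "full BSD
formula for every rank `≤ 1` curve in class `C`" assembled STRICTLY from published theorems — so
that the rank-`≤ 1` remainder becomes exactly the CONSTRUCTION-SHAPED classes, which are TYPED
(missing-input `Prop`s), NOT attempted. This is not "finishing BSD". O1 team (class X5, `p = 2`,
non-CM), ORDER v2.9 pool slot (ii‴) = lens-2 GEN 10's QUADRATIC-SPACE LAYER (o1 lead R-G20.3 /
R-G20.4, PLAN C150); pool hand = seat `b2b-bsdres-x11b3-p3` GEN 8 (offer; files only on the o1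
lead's word). PURE `𝔽₂` LINEAR ALGEBRA about the vocabulary of `X5/SelmerSolitaireQuadratic.lean`
(x11b3-p4, p283641): THEOREMS ONLY (no definition, no named fact, no `sorry`); nothing arithmetic is
asserted (the reading "`λ*(n ∪ q) − λ*(n)` along a Kolyvagin-prime adjunction", lens-2's prediction
P-G10.4, belongs to the AR layer and is NOT here); reach-neutral (R1 closes no class); nothing
booked; O1 OPEN.

## What is proved

Setting (as in QS5 `descentRule_holds`, x11b3-p9 `X5/SelmerSolitaireQuadraticDescent.lean`): `U` a
totally singular Lagrangian of `Q_D`, `ψ` a linear functional, `L` a totally singular Lagrangian of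
`Q_{D ∪ q}` containing `K′_ψ` and not containing `u_q` (the forced move, QS2a), `n ⊆ D`; the coordinate
subspaces enter as arbitrary submodules with membership hypotheses: `Λ₁ = Λ*_n` (`x ∈ Λ₁ ↔ InLamStar n x`),
`Λ₂ = Λ*_{n ∪ q}` (`y ∈ Λ₂ ↔ InLamStar (insert (Fin.last s) (lift n)) y`), and for the `+1` case also
`Λ₀ = Λ_n` (`x ∈ Λ₀ ↔ InLam n x`). lens-2's TRICHOTOMY (D-G10.1, "the true law"; exec 10 080 / 10 080 at
`|D| = 3`), all three cases as `finrank` identities: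

* `descent_minus` (`−1`): `ψ ≠ 0` on `U ∩ Λ*_n` ⇒ `dim (L ∩ Λ*_{n∪q}) + 1 = dim (U ∩ Λ*_n)` (the
  dimension form of QS5);
* `descent_zero` (`0`): `ψ = 0` on `U ∩ Λ*_n` but `ψ ≠ 0` on `U ∩ Λ_n` ⇒ `dim (L ∩ Λ*_{n∪q}) = dim (U ∩ Λ*_n)`;
* `descent_plus` (`+1`): `ψ = 0` on `U ∩ Λ_n` ⇒ `dim (L ∩ Λ*_{n∪q}) = dim (U ∩ Λ*_n) + 1`.

Mechanism (namespace `…Quadratic.Trichotomy`): by x11b3-p4's `eq_span_of_isTSLagrangian` the move is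
`L = span (K′_ψ ∪ {ι η + (q(η), 1)_q})` with `η` the dual vector of `ψ` (`polar_dualVec`), so every
`y ∈ L` is `ι(x + c η) + (ψ x + c q(η), c)_q`; the elements of `L ∩ Λ*_{n∪q}` with `t_q`-coordinate
`0` are exactly `ι (U ∩ Λ*_n ∩ ker ψ)`; an element with `t_q`-coordinate `1` exists iff
`η ∈ U + Λ*_n`, iff (duality in the polar form: `(U + Λ*_n)^⊥ = U ∩ Λ_n`, Mathlib
`LinearMap.BilinForm.orthogonal_orthogonal`, and `U = U^⊥` = Q4a's `mem_of_forall_polar_eq_zero`)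
`ψ = 0` on `U ∩ Λ_n` — in which case the `u_q`-coordinate `ψ x₀ + q(η)` vanishes automatically.

References: lens-2 GEN 10 (2G10.2 QS5 + CORRECTION D-G10.1, 2G10.8 P-G10.4), `cells/o1/ROUTES-O1.md`;
B. Mazur, K. Rubin, *Introduction to Kolyvagin systems*, Contemp. Math. 358 (2004), Prop. 4.3
[cite: MazurRubin2004Intro, Prop. 4.3]; B. Poonen, E. Rains, JAMS 25 (2012) §2 [cite: PoonenRains2012, §2].
Folklore linear algebra.

## Tree search (dedup, 2026-08-21)
`lean search 'Trichotomy|descent_plus|descent_zero|descent_minus'` in `Summits/` → none; consumed BY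
NAME: p4 `eq_span_of_isTSLagrangian` / `mem_span_kPrime_insert_iff` / `polar_dualVec` / `iota_*` /
`eq_iota_add_single` / `qform_iota_add_single` / `polar_*` / `mem_of_forall_polar_eq_zero`, p9
`Descent.inLamStar_res_of_inLamStar_insert` / `Descent.polar_eq_zero_of_inLamStar`, p2 `NF.qform_add`
/ `NF.polar_eq_zero_of_mem`, p3 `Parity.*` / `Cube.*`.
-/

namespace Summit.BirchSwinnertonDyer.Rank1Residual.X5.SelmerSolitaire.Quadratic

open Finset SelmerSolitaire

variable {s : ℕ}

namespace Trichotomy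

/-! ### §1 Coordinates: `Λ*_{n ∪ q}` from the old part and the `u_q`-coordinate -/

/-- Converse of `Descent.inLamStar_res_of_inLamStar_insert`: if the old part of `y` lies in `Λ*_n` and
the `u_q`-coordinate of `y` vanishes then `y ∈ Λ*_{n ∪ q}`. [cite: MazurRubin2004Intro, Def. 4.2] -/
theorem inLamStar_insert_of_res (n : Finset (Fin s)) (y : QVec (s + 1))
    (hy : InLamStar n (fun v => y (oldV v))) (hq : (y (some (Fin.last s))).1 = 0) :
    InLamStar (insert (Fin.last s) (lift n)) y := by
  refine ⟨hy.1, fun j ↦ ?_⟩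
  induction j using Fin.lastCases with
  | last => exact ⟨fun _ ↦ hq, fun h ↦ absurd (mem_insert_self _ _) h⟩
  | cast i =>
    have hmem : Fin.castSucc i ∈ insert (Fin.last s) (lift n) ↔ i ∈ n := by
      rw [Finset.mem_insert, lift, ← Fin.castSuccEmb_apply, Finset.mem_map' Fin.castSuccEmb]
      exact ⟨fun h ↦ h.resolve_left (Fin.castSucc_ne_last i), Or.inr⟩
    have h := hy.2 i
    rw [← hmem] at h
    exact h

/-- Two vectors, one in `Λ*_n` and one in `Λ_n`, pair to `0` (at `∞` the first vanishes, at each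
finite vertex both carry the same vanishing coordinate). [cite: MazurRubin2004Intro, Def. 4.2] -/
theorem polar_eq_zero_of_inLamStar_of_inLam {n : Finset (Fin s)} {m u : QVec s}
    (hm : InLamStar n m) (hu : InLam n u) : polar m u = 0 := by
  unfold polar
  refine Finset.sum_eq_zero fun v _ ↦ ?_
  rcases v with _ | i
  · rw [hm.1]; simp
  · by_cases hi : i ∈ n
    · rw [(hm.2 i).1 hi, (hu i).1 hi]; ring
    · rw [(hm.2 i).2 hi, (hu i).2 hi]; ring

/-- `q` vanishes on `Λ*_n`. [folklore] -/
theorem qform_eq_zero_of_inLamStar {n : Finset (Fin s)} {m : QVec s} (hm : InLamStar n m) :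
    qform m = 0 := by
  rw [Cube.qform_eq_of_inLam hm.2, hm.1]; rfl

/-! ### §2 The elements of the move `L` in coordinates -/

/-- **Coordinates of the move.** With `η` the dual vector of `ψ`, every `y ∈ L` has old part `x + c η`
and `q`-part `(ψ x + c q(η), c)` for some `x ∈ U`, `c ∈ 𝔽₂` (x11b3-p4's `eq_span_of_isTSLagrangian`:
`L = span (K′_ψ ∪ {ι η + (q η, 1)_q})`). [cite: PoonenRains2012, §2] -/
theorem exists_repr {U : Submodule (ZMod 2) (QVec s)} (hU : IsTSLagrangian U)
    (ψ : QVec s →ₗ[ZMod 2] ZMod 2) {L : Submodule (ZMod 2) (QVec (s + 1))} (hL : IsTSLagrangian L)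
    (hK : kPrime U ψ ⊆ (L : Set (QVec (s + 1)))) (hu : uNew s ∉ L) {y : QVec (s + 1)} (hy : y ∈ L) :
    ∃ x ∈ U, ∃ c : ZMod 2,
      (fun v => y (oldV v)) = x + c • (fun v => (ψ (Pi.single v (0, 1)), ψ (Pi.single v (1, 0)))) ∧
      y (some (Fin.last s)) =
        (ψ x + c * qform (fun v => (ψ (Pi.single v (0, 1)), ψ (Pi.single v (1, 0))) : QVec s), c) := by
  set η : QVec s := fun v => (ψ (Pi.single v (0, 1)), ψ (Pi.single v (1, 0))) with hη
  have hηψ : ∀ z, polar η z = ψ z := polar_dualVec ψ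
  have hLspan := eq_span_of_isTSLagrangian hU ψ hηψ hL hK hu
  rw [hLspan, mem_span_kPrime_insert_iff] at hy
  obtain ⟨x, hx, c, rfl⟩ := hy
  refine ⟨x, hx, c, ?_, ?_⟩
  · funext v
    simp only [Pi.add_apply, Pi.smul_apply, iota_apply_oldV, single_new_apply_oldV, smul_zero,
      add_zero, smul_add, uNew_eq_single]
  · simp only [Pi.add_apply, Pi.smul_apply, iota_apply_new, zero_add, uNew_eq_single, Pi.single_eq_same,
      smul_add, smul_zero]
    ext <;> simp

/-! ### §3 `L ∩ Λ*_{n ∪ q}` versus `ι (U ∩ Λ*_n ∩ ker ψ)` -/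

/-- `ι x ∈ L ∩ Λ*_{n∪q}` for `x ∈ U ∩ Λ*_n` with `ψ x = 0`. [cite: MazurRubin2004Intro, Prop. 4.3] -/
theorem iota_mem {U : Submodule (ZMod 2) (QVec s)} (ψ : QVec s →ₗ[ZMod 2] ZMod 2)
    {L : Submodule (ZMod 2) (QVec (s + 1))} (hK : kPrime U ψ ⊆ (L : Set (QVec (s + 1))))
    {n : Finset (Fin s)} (Λ₂ : Submodule (ZMod 2) (QVec (s + 1)))
    (h₂ : ∀ y, y ∈ Λ₂ ↔ InLamStar (insert (Fin.last s) (lift n)) y)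
    {x : QVec s} (hx : x ∈ U) (hxn : InLamStar n x) (hψ : ψ x = 0) : iota x ∈ L ⊓ Λ₂ := by
  refine ⟨?_, (h₂ _).mpr (inLamStar_insert_of_res n _ ?_ (by rw [iota_apply_new]; rfl))⟩
  · have h := hK ⟨x, hx, rfl⟩
    rwa [hψ, zero_smul, add_zero] at h
  · have he : (fun v => iota x (oldV v)) = x := funext fun v ↦ iota_apply_oldV x v
    rw [he]; exact hxn

/-- **The `t_q`-coordinate-`0` part of `L ∩ Λ*_{n∪q}` is `ι (U ∩ Λ*_n ∩ ker ψ)`**: an element `y` of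
`L ∩ Λ*_{n ∪ q}` with `(y_q).2 = 0` is `ι x` with `x ∈ U ∩ Λ*_n`, `ψ x = 0`.
[cite: MazurRubin2004Intro, Prop. 4.3] -/
theorem eq_iota_of_snd_eq_zero {U : Submodule (ZMod 2) (QVec s)} (hU : IsTSLagrangian U)
    (ψ : QVec s →ₗ[ZMod 2] ZMod 2) {L : Submodule (ZMod 2) (QVec (s + 1))} (hL : IsTSLagrangian L)
    (hK : kPrime U ψ ⊆ (L : Set (QVec (s + 1)))) (hu : uNew s ∉ L) {n : Finset (Fin s)}
    {y : QVec (s + 1)} (hyL : y ∈ L) (hyn : InLamStar (insert (Fin.last s) (lift n)) y)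
    (hy2 : (y (some (Fin.last s))).2 = 0) :
    ∃ x ∈ U, InLamStar n x ∧ ψ x = 0 ∧ y = iota x := by
  obtain ⟨x, hx, c, hold, hq⟩ := exists_repr hU ψ hL hK hu hyL
  obtain ⟨hres, hq1⟩ := Descent.inLamStar_res_of_inLamStar_insert n y hyn
  have hc : c = 0 := by rw [hq] at hy2; exact hy2
  rw [hc, zero_smul, add_zero] at hold
  rw [hc, zero_mul, add_zero] at hq
  have hψ : ψ x = 0 := by rw [hq] at hq1; exact hq1
  refine ⟨x, hx, hold ▸ hres, hψ, ?_⟩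
  rw [eq_iota_add_single y, hold, hq, hψ]
  simp

/-- If `ψ ≠ 0` on `U ∩ Λ_n` then EVERY element of `L ∩ Λ*_{n∪q}` has `t_q`-coordinate `0` (a
`t_q`-component would exhibit `η ∈ U + Λ*_n`, i.e. `ψ ⊥ U ∩ Λ_n`). [cite: MazurRubin2004Intro, Prop. 4.3] -/
theorem snd_eq_zero_of_exists {U : Submodule (ZMod 2) (QVec s)} (hU : IsTSLagrangian U)
    (ψ : QVec s →ₗ[ZMod 2] ZMod 2) {L : Submodule (ZMod 2) (QVec (s + 1))} (hL : IsTSLagrangian L)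
    (hK : kPrime U ψ ⊆ (L : Set (QVec (s + 1)))) (hu : uNew s ∉ L) {n : Finset (Fin s)}
    (hψ : ∃ u ∈ U, InLam n u ∧ ψ u ≠ 0)
    {y : QVec (s + 1)} (hyL : y ∈ L) (hyn : InLamStar (insert (Fin.last s) (lift n)) y) :
    (y (some (Fin.last s))).2 = 0 := by
  obtain ⟨x, hx, c, hold, hq⟩ := exists_repr hU ψ hL hK hu hyL
  obtain ⟨hres, -⟩ := Descent.inLamStar_res_of_inLamStar_insert n y hyn
  obtain ⟨u, huU, hun, hψu⟩ := hψ
  have h01 : ∀ a : ZMod 2, a = 0 ∨ a = 1 := by decide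
  rcases h01 c with hc | hc
  · rw [hq, hc]
  · exfalso
    apply hψu
    -- `m := x + η ∈ Λ*_n`, so `ψ u = polar η u = polar m u - polar x u = 0`
    set η : QVec s := fun v => (ψ (Pi.single v (0, 1)), ψ (Pi.single v (1, 0))) with hη
    rw [hc, one_smul] at hold
    have hm : InLamStar n (x + η) := hold ▸ hres
    have h1 : polar (x + η) u = 0 := polar_eq_zero_of_inLamStar_of_inLam hm hun
    rw [polar_add_left, NF.polar_eq_zero_of_mem hU.1 hx huU, zero_add, polar_dualVec] at h1
    exact h1

/-! ### §4 The `−1` and `0` cases -/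

/-- In the cases `−1` / `0` (`ψ ≠ 0` on `U ∩ Λ_n`), `L ∩ Λ*_{n∪q}` is in linear bijection with
`U ∩ Λ*_n ∩ ker ψ` via `ι`: their dimensions agree. [cite: MazurRubin2004Intro, Prop. 4.3] -/
theorem finrank_eq_of_exists {U : Submodule (ZMod 2) (QVec s)} (hU : IsTSLagrangian U)
    (ψ : QVec s →ₗ[ZMod 2] ZMod 2) {L : Submodule (ZMod 2) (QVec (s + 1))} (hL : IsTSLagrangian L)
    (hK : kPrime U ψ ⊆ (L : Set (QVec (s + 1)))) (hu : uNew s ∉ L) {n : Finset (Fin s)}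
    (Λ₁ : Submodule (ZMod 2) (QVec s)) (h₁ : ∀ x, x ∈ Λ₁ ↔ InLamStar n x)
    (Λ₂ : Submodule (ZMod 2) (QVec (s + 1))) (h₂ : ∀ y, y ∈ Λ₂ ↔ InLamStar (insert (Fin.last s) (lift n)) y)
    (hψ : ∃ u ∈ U, InLam n u ∧ ψ u ≠ 0) :
    Module.finrank (ZMod 2) ↥(L ⊓ Λ₂) =
      Module.finrank (ZMod 2) ↥(U ⊓ Λ₁ ⊓ LinearMap.ker ψ) := by
  -- `ι` as a linear map
  obtain ⟨ιl, hιl⟩ : ∃ ιl : QVec s →ₗ[ZMod 2] QVec (s + 1), ∀ x, ιl x = iota x :=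
    ⟨{ toFun := iota, map_add' := iota_add, map_smul' := iota_smul }, fun _ ↦ rfl⟩
  have hinj : Function.Injective ιl := fun x x' h ↦ by
    funext v
    have := congrFun h (oldV v)
    rwa [hιl, hιl, iota_apply_oldV, iota_apply_oldV] at this
  have hmap : (U ⊓ Λ₁ ⊓ LinearMap.ker ψ).map ιl = L ⊓ Λ₂ := by
    apply le_antisymm
    · rintro _ ⟨x, ⟨⟨hxU, hxΛ⟩, hxψ⟩, rfl⟩
      rw [hιl]
      exact iota_mem ψ hK Λ₂ h₂ hxU ((h₁ x).mp hxΛ) (LinearMap.mem_ker.mp hxψ)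
    · rintro y ⟨hyL, hyΛ⟩
      have hyn := (h₂ y).mp hyΛ
      obtain ⟨x, hx, hxn, hψx, rfl⟩ := eq_iota_of_snd_eq_zero hU ψ hL hK hu hyL hyn
        (snd_eq_zero_of_exists hU ψ hL hK hu hψ hyL hyn)
      exact ⟨x, ⟨⟨hx, (h₁ x).mpr hxn⟩, LinearMap.mem_ker.mpr hψx⟩, (hιl x)⟩
  rw [← hmap]
  exact (LinearEquiv.finrank_eq (Submodule.equivMapOfInjective ιl hinj _)).symm

/-- **DESCENT TRICHOTOMY, case `−1`** (the dimension form of QS5): if `ψ ≠ 0` on `U ∩ Λ*_n` then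
`dim (L ∩ Λ*_{n∪q}) + 1 = dim (U ∩ Λ*_n)`. [cite: MazurRubin2004Intro, Prop. 4.3 (ii)] -/
theorem descent_minus {U : Submodule (ZMod 2) (QVec s)} (hU : IsTSLagrangian U)
    (ψ : QVec s →ₗ[ZMod 2] ZMod 2) {L : Submodule (ZMod 2) (QVec (s + 1))} (hL : IsTSLagrangian L)
    (hK : kPrime U ψ ⊆ (L : Set (QVec (s + 1)))) (hu : uNew s ∉ L) {n : Finset (Fin s)}
    (Λ₁ : Submodule (ZMod 2) (QVec s)) (h₁ : ∀ x, x ∈ Λ₁ ↔ InLamStar n x)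
    (Λ₂ : Submodule (ZMod 2) (QVec (s + 1))) (h₂ : ∀ y, y ∈ Λ₂ ↔ InLamStar (insert (Fin.last s) (lift n)) y)
    (hψ : ∃ u ∈ U, InLamStar n u ∧ ψ u ≠ 0) :
    Module.finrank (ZMod 2) ↥(L ⊓ Λ₂) + 1 = Module.finrank (ZMod 2) ↥(U ⊓ Λ₁) := by
  obtain ⟨u₀, hu₀U, hu₀n, hψu₀⟩ := hψ
  have hψ' : ∃ u ∈ U, InLam n u ∧ ψ u ≠ 0 := ⟨u₀, hu₀U, hu₀n.2, hψu₀⟩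
  rw [finrank_eq_of_exists hU ψ hL hK hu Λ₁ h₁ Λ₂ h₂ hψ']
  symm
  refine Parity.finrank_eq_succ_of_forall_mem_or_sub_mem (X := U ⊓ Λ₁) (Y := U ⊓ Λ₁ ⊓ LinearMap.ker ψ)
    inf_le_left ⟨hu₀U, (h₁ u₀).mpr hu₀n⟩ (fun h ↦ hψu₀ (LinearMap.mem_ker.mp h.2)) fun y hy ↦ ?_
  have h01 : ∀ a : ZMod 2, a = 0 ∨ a = 1 := by decide
  rcases h01 (ψ y) with h | h
  · exact Or.inl ⟨hy, LinearMap.mem_ker.mpr h⟩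
  · right
    refine ⟨(U ⊓ Λ₁).sub_mem hy ⟨hu₀U, (h₁ u₀).mpr hu₀n⟩, LinearMap.mem_ker.mpr ?_⟩
    have hu1 : ψ u₀ = 1 := ((h01 (ψ u₀)).resolve_left hψu₀)
    rw [map_sub, h, hu1, sub_self]

/-- **DESCENT TRICHOTOMY, case `0`**: if `ψ = 0` on `U ∩ Λ*_n` but `ψ ≠ 0` on `U ∩ Λ_n` then
`dim (L ∩ Λ*_{n∪q}) = dim (U ∩ Λ*_n)`. [cite: MazurRubin2004Intro, Prop. 4.3] -/
theorem descent_zero {U : Submodule (ZMod 2) (QVec s)} (hU : IsTSLagrangian U)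
    (ψ : QVec s →ₗ[ZMod 2] ZMod 2) {L : Submodule (ZMod 2) (QVec (s + 1))} (hL : IsTSLagrangian L)
    (hK : kPrime U ψ ⊆ (L : Set (QVec (s + 1)))) (hu : uNew s ∉ L) {n : Finset (Fin s)}
    (Λ₁ : Submodule (ZMod 2) (QVec s)) (h₁ : ∀ x, x ∈ Λ₁ ↔ InLamStar n x)
    (Λ₂ : Submodule (ZMod 2) (QVec (s + 1))) (h₂ : ∀ y, y ∈ Λ₂ ↔ InLamStar (insert (Fin.last s) (lift n)) y)
    (hψ0 : ∀ u ∈ U, InLamStar n u → ψ u = 0) (hψ : ∃ u ∈ U, InLam n u ∧ ψ u ≠ 0) :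
    Module.finrank (ZMod 2) ↥(L ⊓ Λ₂) = Module.finrank (ZMod 2) ↥(U ⊓ Λ₁) := by
  have hV : U ⊓ Λ₁ ⊓ LinearMap.ker ψ = U ⊓ Λ₁ :=
    le_antisymm inf_le_left fun x hx ↦ ⟨hx, LinearMap.mem_ker.mpr (hψ0 x hx.1 ((h₁ x).mp hx.2))⟩
  rw [finrank_eq_of_exists hU ψ hL hK hu Λ₁ h₁ Λ₂ h₂ hψ, hV]

/-! ### §5 The `+1` case -/

/-- **Duality step of the `+1` case**: if `ψ = 0` on `U ∩ Λ_n` then its dual vector `η` lies in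
`U + Λ*_n` — because `(U + Λ*_n)^⊥ ⊆ U ∩ Λ_n` (`U = U^⊥`, test vectors of `Λ*_n`) and
`A^{⊥⊥} = A` (Mathlib `LinearMap.BilinForm.orthogonal_orthogonal`). [cite: PoonenRains2012, §2] -/
theorem exists_dualVec_eq_add {U : Submodule (ZMod 2) (QVec s)} (hU : IsTSLagrangian U)
    (ψ : QVec s →ₗ[ZMod 2] ZMod 2) {n : Finset (Fin s)}
    (Λ₀ : Submodule (ZMod 2) (QVec s)) (h₀ : ∀ x, x ∈ Λ₀ ↔ InLam n x)
    (Λ₁ : Submodule (ZMod 2) (QVec s)) (h₁ : ∀ x, x ∈ Λ₁ ↔ InLamStar n x)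
    (hψ : ∀ u ∈ U, InLam n u → ψ u = 0) :
    ∃ x₀ ∈ U, ∃ m ∈ Λ₁,
      (fun v => (ψ (Pi.single v (0, 1)), ψ (Pi.single v (1, 0))) : QVec s) = x₀ + m := by
  classical
  set η : QVec s := fun v => (ψ (Pi.single v (0, 1)), ψ (Pi.single v (1, 0))) with hη
  -- the polar form as a nondegenerate reflexive bilinear form
  let B : LinearMap.BilinForm (ZMod 2) (QVec s) :=
    LinearMap.mk₂ (ZMod 2) polar polar_add_left polar_smul_left polar_add_right polar_smul_right
  have hBapply : ∀ x y, B x y = polar x y := fun _ _ ↦ rfl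
  have hB : B.Nondegenerate :=
    ⟨fun x hx ↦ eq_zero_of_forall_polar_eq_zero fun y ↦ by rw [← hBapply]; exact hx y,
     fun y hy ↦ eq_zero_of_forall_polar_eq_zero fun x ↦ by rw [polar_comm, ← hBapply]; exact hy x⟩
  have hBr : B.IsRefl := fun x y h ↦ by rw [hBapply] at h ⊢; rwa [polar_comm]
  -- `(U + Λ*_n)^⊥ ≤ U ∩ Λ_n`
  have hO : B.orthogonal (U ⊔ Λ₁) ≤ U ⊓ Λ₀ := by
    intro y hy
    rw [LinearMap.BilinForm.mem_orthogonal_iff] at hy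
    have hy' : ∀ z ∈ U ⊔ Λ₁, polar z y = 0 := fun z hz ↦ by rw [← hBapply]; exact hy z hz
    refine ⟨mem_of_forall_polar_eq_zero hU fun u hu ↦ by
      rw [polar_comm]; exact hy' u (Submodule.mem_sup_left hu), (h₀ y).mpr fun i ↦ ⟨fun hi ↦ ?_, fun hi ↦ ?_⟩⟩
    · have hmem : (Pi.single (some i : V s) ((0, 1) : ZMod 2 × ZMod 2)) ∈ Λ₁ :=
        (h₁ _).mpr ⟨by rw [Pi.single_eq_of_ne (Option.some_ne_none i).symm],
          Parity.inLam_single_snd hi 1⟩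
      have := hy' _ (Submodule.mem_sup_right hmem)
      rwa [polar_comm, polar_single_snd] at this
    · have hmem : (Pi.single (some i : V s) ((1, 0) : ZMod 2 × ZMod 2)) ∈ Λ₁ :=
        (h₁ _).mpr ⟨by rw [Pi.single_eq_of_ne (Option.some_ne_none i).symm],
          Parity.inLam_single_fst hi 1⟩
      have := hy' _ (Submodule.mem_sup_right hmem)
      rwa [polar_comm, polar_single_fst] at this
  have hle : B.orthogonal (U ⊓ Λ₀) ≤ U ⊔ Λ₁ :=
    (LinearMap.BilinForm.orthogonal_le hO).trans
      (LinearMap.BilinForm.orthogonal_orthogonal hB hBr (U ⊔ Λ₁)).le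
  have hηorth : η ∈ B.orthogonal (U ⊓ Λ₀) := by
    rw [LinearMap.BilinForm.mem_orthogonal_iff]
    rintro u ⟨huU, huΛ⟩
    rw [hBapply, polar_comm, polar_dualVec]
    exact hψ u huU ((h₀ u).mp huΛ)
  obtain ⟨x₀, hx₀, m, hm, h⟩ := Submodule.mem_sup.mp (hle hηorth)
  exact ⟨x₀, hx₀, m, hm, h.symm⟩

/-- **A `t_q`-component exists in the `+1` case**: if `ψ = 0` on `U ∩ Λ_n` there is
`y₁ ∈ L ∩ Λ*_{n∪q}` with `(y₁,q).2 = 1` (namely `y₁ = ι x₀ + ψ(x₀) u_q + (ι η + (q η, 1)_q)` for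
`η = x₀ + m`, whose `u_q`-coordinate `ψ x₀ + q(η) = 2⟨x₀, m⟩` vanishes). [cite: MazurRubin2004Intro, Prop. 4.3] -/
theorem exists_mem_snd_eq_one {U : Submodule (ZMod 2) (QVec s)} (hU : IsTSLagrangian U)
    (ψ : QVec s →ₗ[ZMod 2] ZMod 2) {L : Submodule (ZMod 2) (QVec (s + 1))} (hL : IsTSLagrangian L)
    (hK : kPrime U ψ ⊆ (L : Set (QVec (s + 1)))) (hu : uNew s ∉ L) {n : Finset (Fin s)}
    (Λ₀ : Submodule (ZMod 2) (QVec s)) (h₀ : ∀ x, x ∈ Λ₀ ↔ InLam n x)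
    (Λ₁ : Submodule (ZMod 2) (QVec s)) (h₁ : ∀ x, x ∈ Λ₁ ↔ InLamStar n x)
    (Λ₂ : Submodule (ZMod 2) (QVec (s + 1))) (h₂ : ∀ y, y ∈ Λ₂ ↔ InLamStar (insert (Fin.last s) (lift n)) y)
    (hψ : ∀ u ∈ U, InLam n u → ψ u = 0) :
    ∃ y₁ ∈ L ⊓ Λ₂, (y₁ (some (Fin.last s))).2 = 1 := by
  set η : QVec s := fun v => (ψ (Pi.single v (0, 1)), ψ (Pi.single v (1, 0))) with hη
  have hηψ : ∀ z, polar η z = ψ z := polar_dualVec ψ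
  obtain ⟨x₀, hx₀, m, hm, hηeq⟩ := exists_dualVec_eq_add hU ψ Λ₀ h₀ Λ₁ h₁ hψ
  rw [← hη] at hηeq
  have hmn : InLamStar n m := (h₁ m).mp hm
  -- the candidate
  set y₁ : QVec (s + 1) := iota x₀ + ψ x₀ • uNew s +
    (1 : ZMod 2) • (iota η + Pi.single (some (Fin.last s)) ((qform η, 1) : ZMod 2 × ZMod 2)) with hy₁
  have hy₁L : y₁ ∈ L := by
    rw [eq_span_of_isTSLagrangian hU ψ hηψ hL hK hu, mem_span_kPrime_insert_iff]
    exact ⟨x₀, hx₀, 1, rfl⟩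
  -- coordinates of `y₁`
  have hold : (fun v => y₁ (oldV v)) = m := by
    funext v
    simp only [hy₁, one_smul, Pi.add_apply, Pi.smul_apply, iota_apply_oldV, uNew_eq_single,
      single_new_apply_oldV, smul_zero, add_zero]
    have := congrFun hηeq v
    rw [Pi.add_apply] at this
    rw [this, ← add_assoc, CharTwo.add_self_eq_zero, zero_add]
  have hu0 : ψ x₀ + qform η = 0 := by
    have hq : qform η = polar x₀ m := by
      rw [hηeq, NF.qform_add, hU.1 x₀ hx₀, qform_eq_zero_of_inLamStar hmn, zero_add, zero_add]
    have hp : ψ x₀ = polar m x₀ := by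
      rw [← hηψ, hηeq, polar_add_left, polar_self, zero_add]
    rw [hq, hp, polar_comm, CharTwo.add_self_eq_zero]
  have hq : y₁ (some (Fin.last s)) = (0, 1) := by
    simp only [hy₁, one_smul, Pi.add_apply, Pi.smul_apply, iota_apply_new, zero_add, uNew_eq_single,
      Pi.single_eq_same]
    ext
    · simpa using hu0
    · simp
  refine ⟨y₁, ⟨hy₁L, (h₂ _).mpr (inLamStar_insert_of_res n y₁ (hold ▸ hmn) (by rw [hq]))⟩, by rw [hq]⟩

/-- **DESCENT TRICHOTOMY, case `+1`**: if `ψ = 0` on `U ∩ Λ_n` then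
`dim (L ∩ Λ*_{n∪q}) = dim (U ∩ Λ*_n) + 1`. [cite: MazurRubin2004Intro, Prop. 4.3] -/
theorem descent_plus {U : Submodule (ZMod 2) (QVec s)} (hU : IsTSLagrangian U)
    (ψ : QVec s →ₗ[ZMod 2] ZMod 2) {L : Submodule (ZMod 2) (QVec (s + 1))} (hL : IsTSLagrangian L)
    (hK : kPrime U ψ ⊆ (L : Set (QVec (s + 1)))) (hu : uNew s ∉ L) {n : Finset (Fin s)}
    (Λ₀ : Submodule (ZMod 2) (QVec s)) (h₀ : ∀ x, x ∈ Λ₀ ↔ InLam n x)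
    (Λ₁ : Submodule (ZMod 2) (QVec s)) (h₁ : ∀ x, x ∈ Λ₁ ↔ InLamStar n x)
    (Λ₂ : Submodule (ZMod 2) (QVec (s + 1))) (h₂ : ∀ y, y ∈ Λ₂ ↔ InLamStar (insert (Fin.last s) (lift n)) y)
    (hψ : ∀ u ∈ U, InLam n u → ψ u = 0) :
    Module.finrank (ZMod 2) ↥(L ⊓ Λ₂) = Module.finrank (ZMod 2) ↥(U ⊓ Λ₁) + 1 := by
  -- `ι` as a linear map and the image `Y = ι (U ∩ Λ*_n)` (here `ψ` vanishes on `U ∩ Λ*_n`)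
  obtain ⟨ιl, hιl⟩ : ∃ ιl : QVec s →ₗ[ZMod 2] QVec (s + 1), ∀ x, ιl x = iota x :=
    ⟨{ toFun := iota, map_add' := iota_add, map_smul' := iota_smul }, fun _ ↦ rfl⟩
  have hinj : Function.Injective ιl := fun x x' h ↦ by
    funext v
    have := congrFun h (oldV v)
    rwa [hιl, hιl, iota_apply_oldV, iota_apply_oldV] at this
  have hYfin : Module.finrank (ZMod 2) ↥((U ⊓ Λ₁).map ιl) = Module.finrank (ZMod 2) ↥(U ⊓ Λ₁) :=
    (LinearEquiv.finrank_eq (Submodule.equivMapOfInjective ιl hinj _)).symm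
  rw [← hYfin]
  obtain ⟨y₁, hy₁, hy₁q⟩ := exists_mem_snd_eq_one hU ψ hL hK hu Λ₀ h₀ Λ₁ h₁ Λ₂ h₂ hψ
  -- elements of `Y` have `t_q`-coordinate `0`
  have hY2 : ∀ y ∈ (U ⊓ Λ₁).map ιl, (y (some (Fin.last s))).2 = 0 := by
    rintro _ ⟨x, -, rfl⟩
    rw [hιl, iota_apply_new]; rfl
  refine Parity.finrank_eq_succ_of_forall_mem_or_sub_mem (X := L ⊓ Λ₂) (Y := (U ⊓ Λ₁).map ιl)
    ?_ hy₁ (fun h ↦ ?_) fun y hy ↦ ?_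
  · rintro _ ⟨x, ⟨hxU, hxΛ⟩, rfl⟩
    rw [hιl]
    exact iota_mem ψ hK Λ₂ h₂ hxU ((h₁ x).mp hxΛ) (hψ x hxU ((h₁ x).mp hxΛ).2)
  · have := hY2 y₁ h
    rw [hy₁q] at this
    exact one_ne_zero this
  · have h01 : ∀ a : ZMod 2, a = 0 ∨ a = 1 := by decide
    have key : ∀ z ∈ L ⊓ Λ₂, (z (some (Fin.last s))).2 = 0 → z ∈ (U ⊓ Λ₁).map ιl := by
      rintro z ⟨hzL, hzΛ⟩ hz2
      obtain ⟨x, hx, hxn, -, rfl⟩ :=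
        eq_iota_of_snd_eq_zero hU ψ hL hK hu hzL ((h₂ z).mp hzΛ) hz2
      exact ⟨x, ⟨hx, (h₁ x).mpr hxn⟩, hιl x⟩
    rcases h01 ((y (some (Fin.last s))).2) with h | h
    · exact Or.inl (key y hy h)
    · right
      refine key (y - y₁) ((L ⊓ Λ₂).sub_mem hy hy₁) ?_
      rw [Pi.sub_apply, Prod.snd_sub, h, hy₁q, sub_self]

end Trichotomy

end Summit.BirchSwinnertonDyer.Rank1Residual.X5.SelmerSolitaire.Quadratic
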